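import Literature.Analysis.FluidPDE.NSSereginMildFacts
import Literature.Analysis.FluidPDE.NSSereginMildRescaling
import Literature.Analysis.FluidPDE.LocalLerayWeakStrong
import Literature.Analysis.FluidPDE.MildL3Restart
import Literature.Analysis.FluidPDE.SelfSimilar
import HarnessLib

/-!
# Seregin's `L³` criterion: the core fact from the local-Leray theory (assembly)

Analysis/FluidPDE proof file. It **proves** the named fact
`Literature.Analysis.FluidPDE.seregin_regular_of_liminf_L3` (`NSLerayHopfSereginMild.lean`:
a Kato solution `u` on `[0, T)` with `liminf_{t↑T} ‖u(t)‖₃ < ∞` is essentially bounded on a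
backward parabolic cylinder `Q_r(T, x₀)` at every `x₀` — the core of Lemarié-Rieusset 2016,
Thm. 15.5 = Seregin 2012, Thm. 1.1) from the four named facts of `NSSereginMildFacts.lean`
(Prop. 15.1; the limiting procedure; the stability of a singular point at the final time;
Thm. 15.4), the two named facts **U** (Thm. 14.7, weak–strong uniqueness) and **A**
(Thm. 15.1 (A)) of `LocalLerayWeakStrong.lean`, and the proved restart of mild `C_t L³` solutions
(`IsMildNSSolutionOn.isMildNSSolutionBetween_of_continuousInLpOn_three`, `MildL3Restart.lean`),
following the printed proof (PDF pp. 570–573 of doi:10.1201/b19556) line by line. Thm. 15.1 (B)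
("`v = u` on `(0, min(T, T*))` by the weak–strong uniqueness theorem") is **proved** here from U
and A in the form needed: a.e. on every shorter strip (`IsLocalLeraySolutionOn.ae_eq_uncurry_kato`,
the height-truncation splitting of `LocalLerayWeakStrong.lean`), upgraded to every slice for
weakly-continuous-in-time solutions (`IsLocalEnergySolutionOn.ae_eq_kato_slice`: a continuous
function of time vanishing a.e. vanishes).

1. (*Contradiction hypothesis.*) Suppose `u` is unbounded on every `Q_r(T, x₀)` and pick
   `T_n ↑ T` in `(0, T)` with `‖u(T_n)‖₃ ≤ M` (from the `liminf` hypothesis, a countably generated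
   filter).
2. (*The profile.*) Prop. 15.1 continues `u₀` to a local Leray solution `U` on `(0, T + 1)`; by
   Thm. 15.1 (B) (from U and A) `U(s) = u(s)` for `s ∈ (0, T)`; by weak continuity `∫⟪U(T), φ⟫ =
   lim ∫⟪u(T_n), φ⟫`, so `|∫⟪U(T), φ⟫| ≤ M ‖φ‖_{3/2}` and `U(T) ∈ L³`
   (`memLp_three_of_forall_abs_integral_inner_le`) — "`u(1,.) ∈ L³`", p. 573.
3. (*Blow-up sequence.*) `u_n(t, x) = λ_n u(T_n + λ_n² t, x₀ + λ_n x)`, `λ_n² = T − T_n`, is a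
   Kato solution on `[0, 1)` (`IsKatoSolutionOn.restart`, `isKatoSolutionOn_blowup`) with
   datum `a_n`,
   `‖a_n‖₃ = ‖u(T_n)‖₃ ≤ M`, unbounded on every `Q_r(1, 0)`.
4. (*Local Leray continuations.*) Prop. 15.1 with `T₀ = 2` gives `v_n` on `(0, 2)` with uniform
   bounds `C, η`; by Thm. 15.1 (B) `v_n(t) = u_n(t)` on `(0, 1)`, so `v_n` is unbounded on every
   `Q_r(1, 0)`, and by weak continuity at `t = 1` its final slice is
   `v_n(1) = λ_n U(T)(x₀ + λ_n ·)` (the pairings `∫⟪v_n(t), φ⟫ = λ_n⁻²∫⟪U(T_n + λ_n²t), φ_n⟫`,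
   `φ_n = φ(λ_n⁻¹(· − x₀))`, have the same limit as `t ↑ 1`).
5. (*Limit.*) The compactness fact yields `n_k` and a local Leray solution `v_∞` on `(0, 1)` with
   `L³` datum, `v_{n_k}(t) → v_∞(t)` in `𝒟'` for `t ∈ [0, 1]`, `v_{n_k} → v_∞` in `L²_loc`.
6. (*Singular.*) Were `v_∞` bounded on some `Q_r(1, 0)`, the stability fact would make `v_{n_k}`
   bounded on some `Q_{r₁}(1, 0)` for large `k` — against 4. So `v_∞` is singular at `(1, 0)`.
7. (*Final value.*) `∫⟪v_∞(1), φ⟫ = lim ∫⟪λ_{n_k} U(T)(x₀ + λ_{n_k}·), φ⟫ = 0`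
   (`tendsto_integral_inner_blowup_of_memLp_three`, `U(T) ∈ L³`), so `v_∞(1) = 0` a.e.
8. (*Backward uniqueness.*) Thm. 15.4: `v_∞ = 0` on `(0, 1) × ℝ³` — bounded on `Q_{1/2}(1, 0)`,
   contradicting 6.

No statement is introduced; with this file the trust base of `seregin_L3_blowup_mild` (hence of
**ns.S08** `seregin_L3_blowup`) below `NSLerayHopfSereginMild.lean` is
`lemarieRieusset_singular_point_of_blowup` (Thm. 15.1 (C)), the four facts of
`NSSereginMildFacts.lean`, and U, A of `LocalLerayWeakStrong.lean` (Thm. 14.7, Thm. 15.1 (A)).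

## References

* P. G. Lemarié-Rieusset, *The Navier–Stokes Problem in the 21st Century*, CRC Press (2016),
  doi:10.1201/b19556, Thm. 15.5 and its proof, PDF pp. 570–573.
* G. Seregin, Comm. Math. Phys. 312 (2012) = arXiv:1104.3615, §§2–4; *Lecture notes* (2014),
  Ch. 7.
-/

noncomputable section

open MeasureTheory TopologicalSpace Set Function Filter Metric
open _root_.Topology
open scoped ENNReal NNReal RealInnerProductSpace

namespace Literature.Analysis.FluidPDE

/-! ### `ℝ³` instances of the rescaling lemmas

(The generic lemmas of `NSSereginMildRescaling.lean` take `dim E = 3` as a hypothesis; the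
specialisations below fix `E = ℝ³` once, so that the assembly does not re-unify the instance
paths at every use.) -/

/-- `integral_inner_blowup_eq` on `ℝ³`. [folklore] -/
theorem integral_inner_blowup_eq_fin3 (V φ : EuclideanSpace ℝ (Fin 3) → EuclideanSpace ℝ (Fin 3))
    {c : ℝ} (hc : 0 < c) (x₀ : EuclideanSpace ℝ (Fin 3)) :
    ∫ x, ⟪c • V (x₀ + c • x), φ x⟫ = c * (c ^ 3)⁻¹ * ∫ y, ⟪V y, φ (c⁻¹ • (y - x₀))⟫ :=
  integral_inner_blowup_eq finrank_euclideanSpace_fin V φ hc x₀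

/-- `tendsto_integral_inner_blowup_of_memLp_three` on `ℝ³`. [folklore] -/
theorem tendsto_integral_inner_blowup_of_memLp_three_fin3
    {V : EuclideanSpace ℝ (Fin 3) → EuclideanSpace ℝ (Fin 3)} (hV : MemLp V 3 volume)
    {φ : EuclideanSpace ℝ (Fin 3) → EuclideanSpace ℝ (Fin 3)}
    (hφ : FunctionSpaces.IsTestFunctionOn (⊤ : Opens (EuclideanSpace ℝ (Fin 3))) φ)
    (x₀ : EuclideanSpace ℝ (Fin 3)) {c : ℕ → ℝ} (hc : ∀ n, 0 < c n)
    (hc0 : Tendsto c atTop (𝓝 0)) :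
    Tendsto (fun n => ∫ x, ⟪c n • V (x₀ + c n • x), φ x⟫) atTop (𝓝 0) :=
  tendsto_integral_inner_blowup_of_memLp_three finrank_euclideanSpace_fin hV hφ x₀ hc hc0

/-! ### Restarting a Kato solution (proved) -/

/-- **Restart of a Kato solution at a time `s ∈ [0, T)`**: `t ↦ u(s + t)` is a Kato solution on
`[0, T − s)` with datum `u(s)`. The mild clause is the two-time duality identity of
`C([0,T); L³)` mild solutions proved in `MildL3Restart.lean`
(`IsMildNSSolutionOn.isMildNSSolutionBetween_of_continuousInLpOn_three`; Fabes–Jones–Rivière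
1972, Thm. 2.1; Lemarié-Rieusset 2016, Thm. 6.1 with Prop. 6.5, and proof of Thm. 7.7, first
step, p. 169), translated in time (`IsMildNSSolutionBetween.comp_add_right_zero`); continuity in
`L³` and measurability translate by `isKatoSolutionOn_restart_of_mild`. [cite: LemarieRieusset2016, proof of Thm. 7.7, first step, p. 169] -/
theorem IsKatoSolutionOn.restart {T ν s : ℝ}
    {u₀ : EuclideanSpace ℝ (Fin 3) → EuclideanSpace ℝ (Fin 3)}
    {u : ℝ → EuclideanSpace ℝ (Fin 3) → EuclideanSpace ℝ (Fin 3)}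
    (hν : 0 < ν) (hu : IsKatoSolutionOn T ν u₀ u) (hs : s ∈ Ico 0 T) :
    IsKatoSolutionOn (T - s) ν (u s) (fun t => u (s + t)) := by
  have hT : 0 < T := hs.1.trans_lt hs.2
  have hu₀ : MemLp u₀ 3 volume := hu.memLp_initial hT
  have hmild' : IsMildNSSolutionOn (Ico 0 (T - s)) ν 0 (u s) (fun t => u (t + s)) := by
    refine ⟨fun t ht => hu.mild.1 (t + s) ⟨by linarith [ht.1, hs.1], by linarith [ht.2]⟩,
      fun t ht => ?_⟩
    have hb : IsMildNSSolutionBetween ν 0 u (0 + s) (t + s) := by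
      rw [zero_add]
      exact hu.mild.isMildNSSolutionBetween_of_continuousInLpOn_three finrank_euclideanSpace_fin hν
        hu₀ hu.continuousInLpOn hu.aestronglyMeasurable hs.1 (by linarith [ht.1])
        (by linarith [ht.2])
    have h2 : IsMildNSSolutionBetween ν 0 (fun τ => u (τ + s)) 0 t := hb.comp_add_right_zero
    have h3 : IsMildNSSolutionFrom ν 0 ((fun τ => u (τ + s)) 0) (fun τ => u (τ + s)) t :=
      isMildNSSolutionFrom_self_iff.2 h2
    simpa only [zero_add] using h3
  have e : (fun t => u (t + s)) = fun t => u (s + t) := by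
    funext t; rw [add_comm]
  rw [e] at hmild'
  exact isKatoSolutionOn_restart_of_mild hu hs hmild'

/-! ### Thm. 15.1 (B) from the facts U (Thm. 14.7) and A (Thm. 15.1 (A)) -/

/-- **Thm. 15.1 (B), a.e. on shorter strips, from U and A** (Lemarié-Rieusset 2016, Thm. 15.1 (B),
PDF p. 565: "We have `v = u` on `(0, min(T, T*))` by the weak–strong uniqueness theorem
(Theorem 14.7)"; the bookkeeping is that of the accepted `leray_ae_eq_kato_of_local_leray_theory`,
Step 1): for `ν > 0`, a Kato solution `u` on `[0, T')` with datum `u₀` and a local Leray solution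
`(v, π)` on the slab `(0, T)` with the same datum, `v = u` a.e. on `(0, S) × ℝ³` for every
`0 < S < T'`, `S ≤ T` — **A** makes `u` a local Leray solution on `(0, S)`, `u` splits by height
truncation into a bounded part and a part with `L³`-tails `≤ ε₀ν/2` on `[0, S]`
(`IsKatoSolutionOn.exists_truncation_split`), `u₀ ∈ L³ ⊂ E²`, and **U** applies — all of which
is now `IsLocalLeraySolutionOn.ae_eq_kato_of_local_leray_theory` (`LocalLerayWeakStrong.lean`), of
which this theorem is the alias kept for its importers.
[cite: LemarieRieusset2016, Thm. 15.1 (B), proof (file p. 565)] -/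
theorem IsLocalLeraySolutionOn.ae_eq_uncurry_kato (hU : local_leray_weak_strong_uniqueness)
    (hA : kato_isLocalLeraySolutionOn) {ν T T' : ℝ} (hν : 0 < ν)
    {u₀ : EuclideanSpace ℝ (Fin 3) → EuclideanSpace ℝ (Fin 3)}
    {u v : ℝ → EuclideanSpace ℝ (Fin 3) → EuclideanSpace ℝ (Fin 3)}
    {π : ℝ → EuclideanSpace ℝ (Fin 3) → ℝ}
    (hu : IsKatoSolutionOn T' ν u₀ u) (hv : IsLocalLeraySolutionOn T ν u₀ v π)
    {S : ℝ} (hS : 0 < S) (hST' : S < T') (hST : S ≤ T) :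
    uncurry v =ᵐ[volume.restrict (Ioo 0 S ×ˢ (univ : Set (EuclideanSpace ℝ (Fin 3))))]
      uncurry u :=
  -- the facts U and A are consumed through their single interface in `LocalLerayWeakStrong.lean`
  IsLocalLeraySolutionOn.ae_eq_kato_of_local_leray_theory hU hA hν hu hv hS hST' hST

/-- **Pairings of a Kato solution with test fields are continuous in time** on `[0, T)`
(`|∫⟪u(t) − u(t₀), φ⟫| ≤ ‖u(t) − u(t₀)‖₃ ‖φ‖_{3/2}`, and `u ∈ C([0,T); L³)`). [folklore] -/
theorem IsKatoSolutionOn.continuousOn_integral_inner {T ν : ℝ}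
    {u₀ : EuclideanSpace ℝ (Fin 3) → EuclideanSpace ℝ (Fin 3)}
    {u : ℝ → EuclideanSpace ℝ (Fin 3) → EuclideanSpace ℝ (Fin 3)}
    (hu : IsKatoSolutionOn T ν u₀ u) {φ : EuclideanSpace ℝ (Fin 3) → EuclideanSpace ℝ (Fin 3)}
    (hφ : FunctionSpaces.IsTestFunctionOn (⊤ : Opens (EuclideanSpace ℝ (Fin 3))) φ) :
    ContinuousOn (fun t => ∫ x, ⟪u t x, φ x⟫) (Ico 0 T) := by
  intro t₀ ht₀
  have hφq : MemLp φ (3 / 2 : ℝ≥0∞) volume :=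
    hφ.contDiff.continuous.memLp_of_hasCompactSupport hφ.hasCompactSupport
  have hlim := hu.continuousInLpOn.2 t₀ ht₀
  rw [ContinuousWithinAt, tendsto_iff_norm_sub_tendsto_zero]
  have hbound : ∀ t ∈ Ico 0 T, ‖(∫ x, ⟪u t x, φ x⟫) - ∫ x, ⟪u t₀ x, φ x⟫‖ ≤
      (eLpNorm (u t - u t₀) 3 volume).toReal * (eLpNorm φ (3 / 2 : ℝ≥0∞) volume).toReal := by
    intro t ht
    have hi : ∀ s ∈ Ico 0 T, Integrable (fun x => ⟪u s x, φ x⟫) volume := fun s hs =>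
      integrable_inner_of_locallyIntegrable_of_hasCompactSupport
        ((hu.memLp hs).locallyIntegrable (by norm_num)) hφ.contDiff.continuous hφ.hasCompactSupport
    rw [← integral_sub (hi t ht) (hi t₀ ht₀), Real.norm_eq_abs]
    have e : (fun x => ⟪u t x, φ x⟫ - ⟪u t₀ x, φ x⟫) = fun x => ⟪(u t - u t₀) x, φ x⟫ := by
      funext x; simp [inner_sub_left]
    rw [e]
    exact abs_integral_inner_le_eLpNorm_three_mul ((hu.memLp ht).sub (hu.memLp ht₀)) hφq
  have hlim' : Tendsto (fun t => (eLpNorm (u t - u t₀) 3 volume).toReal *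
      (eLpNorm φ (3 / 2 : ℝ≥0∞) volume).toReal) (𝓝[Ico 0 T] t₀) (𝓝 0) := by
    have h1 : Tendsto (fun t => (eLpNorm (u t - u t₀) 3 volume).toReal) (𝓝[Ico 0 T] t₀)
        (𝓝 0) := by
      have := (ENNReal.tendsto_toReal ENNReal.zero_ne_top).comp hlim
      rwa [ENNReal.toReal_zero] at this
    simpa using h1.mul_const (eLpNorm φ (3 / 2 : ℝ≥0∞) volume).toReal
  exact squeeze_zero_norm' (eventually_mem_nhdsWithin.mono fun t ht => by
    rw [norm_norm]; exact hbound t ht) hlim'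

/-- **Thm. 15.1 (B) at every time** for solutions in Seregin's weakly-continuous-in-time class
(Lemarié-Rieusset 2016, Thm. 15.1 (B): "`v = u` on `(0, min(T, T*))`"): for `ν > 0`, a Kato
solution `u` on `[0, T')` with datum `u₀` and a local energy solution `(v, π)` on
`ℝ³ × (0, T)` with the same datum, `v(t) = u(t)` a.e. for **every** `t ∈ (0, min(T, T'))`.
From the a.e.-on-strips statement (`IsLocalLeraySolutionOn.ae_eq_uncurry_kato`): for each test
field `φ` the continuous function `t ↦ ∫⟪v(t), φ⟫ − ∫⟪u(t), φ⟫` vanishes for a.e. `t`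
(Fubini), hence for every `t` (`Measure.eqOn_open_of_ae_eq`), and two locally integrable fields
with equal pairings coincide a.e. (du Bois-Reymond). [cite: LemarieRieusset2016, Thm. 15.1 (B), p. 565] -/
theorem IsLocalEnergySolutionOn.ae_eq_kato_slice (hU : local_leray_weak_strong_uniqueness)
    (hA : kato_isLocalLeraySolutionOn) {ν T T' : ℝ} (hν : 0 < ν)
    {u₀ : EuclideanSpace ℝ (Fin 3) → EuclideanSpace ℝ (Fin 3)}
    {u v : ℝ → EuclideanSpace ℝ (Fin 3) → EuclideanSpace ℝ (Fin 3)}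
    {π : ℝ → EuclideanSpace ℝ (Fin 3) → ℝ}
    (hu : IsKatoSolutionOn T' ν u₀ u) (hv : IsLocalEnergySolutionOn T ν u₀ v π) :
    ∀ t ∈ Ioo 0 (min T T'), v t =ᵐ[volume] u t := by
  intro t ht
  -- a strip `(0, S)` with `t < S < min T T'`
  set S : ℝ := (t + min T T') / 2 with hS_def
  have htS : t < S := by rw [hS_def]; linarith [ht.2]
  have hSlt : S < min T T' := by rw [hS_def]; linarith [ht.2]
  have hS : 0 < S := ht.1.trans htS
  have hST' : S < T' := hSlt.trans_le (min_le_right _ _)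
  have hST : S ≤ T := (hSlt.trans_le (min_le_left _ _)).le
  have hstrip := IsLocalLeraySolutionOn.ae_eq_uncurry_kato hU hA hν hu hv.isLocalLeraySolutionOn
    hS hST' hST
  -- Fubini: `v s = u s` a.e., for a.e. `s ∈ (0, S)`
  have hprod : (volume : Measure (ℝ × EuclideanSpace ℝ (Fin 3))).restrict
      (Ioo 0 S ×ˢ (univ : Set (EuclideanSpace ℝ (Fin 3)))) =
      ((volume : Measure ℝ).restrict (Ioo 0 S)).prod (volume : Measure (EuclideanSpace ℝ (Fin 3))) := by
    rw [Measure.volume_eq_prod, ← Measure.restrict_univ (μ := (volume : Measure (EuclideanSpace ℝ (Fin 3)))),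
      Measure.prod_restrict, Measure.restrict_univ]
  rw [hprod] at hstrip
  have hae : ∀ᵐ s ∂((volume : Measure ℝ).restrict (Ioo 0 S)), v s =ᵐ[volume] u s :=
    Measure.ae_ae_of_ae_prod hstrip
  -- for each test field the pairings agree at every `s ∈ (0, S)`
  have hpair : ∀ φ : EuclideanSpace ℝ (Fin 3) → EuclideanSpace ℝ (Fin 3),
      FunctionSpaces.IsTestFunctionOn (⊤ : Opens (EuclideanSpace ℝ (Fin 3))) φ →
        ∀ s ∈ Ioo 0 S, ∫ x, ⟪v s x, φ x⟫ = ∫ x, ⟪u s x, φ x⟫ := by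
    intro φ hφ
    have hcv : ContinuousOn (fun s => ∫ x, ⟪v s x, φ x⟫) (Ioo 0 S) :=
      (hv.weakContinuous φ hφ).mono fun s hs => ⟨hs.1.le, hs.2.le.trans hST⟩
    have hcu : ContinuousOn (fun s => ∫ x, ⟪u s x, φ x⟫) (Ioo 0 S) :=
      (hu.continuousOn_integral_inner hφ).mono fun s hs => ⟨hs.1.le, hs.2.trans hST'⟩
    have haeφ : (fun s => ∫ x, ⟪v s x, φ x⟫) =ᵐ[(volume : Measure ℝ).restrict (Ioo 0 S)]
        fun s => ∫ x, ⟪u s x, φ x⟫ :=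
      hae.mono fun s hs => integral_congr_ae (hs.mono fun x hx => by simp only [hx])
    exact Measure.eqOn_open_of_ae_eq haeφ isOpen_Ioo hcv hcu
  -- du Bois-Reymond at the time `t`
  have htT : t ∈ Icc 0 T := ⟨ht.1.le, (htS.trans hSlt).le.trans (min_le_left _ _)⟩
  have htT' : t ∈ Ico 0 T' := ⟨ht.1.le, htS.trans hST'⟩
  exact FunctionSpaces.ae_eq_of_forall_integral_inner_test_eq (hv.locallyIntegrable_slice htT)
    ((hu.memLp htT').locallyIntegrable (by norm_num)) fun φ hφ => hpair φ hφ t ⟨ht.1, htS⟩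

/-- **A sequence of times from a `liminf` hypothesis**: if `p` holds frequently as `t ↑ T`
(`T > 0`), there are `T_n ∈ (0, T)` with `p(T_n)` and `T_n → T`. [folklore] -/
theorem exists_seq_of_frequently_nhdsLT {T : ℝ} (hT : 0 < T) {p : ℝ → Prop}
    (h : ∃ᶠ t in 𝓝[<] T, p t) :
    ∃ Tn : ℕ → ℝ, (∀ n, Tn n ∈ Ioo 0 T) ∧ (∀ n, p (Tn n)) ∧ Tendsto Tn atTop (𝓝 T) := by
  have h' : ∃ᶠ t in 𝓝[<] T, p t ∧ t ∈ Ioo 0 T := h.and_eventually (Ioo_mem_nhdsLT hT)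
  obtain ⟨Tn, hTn, hp⟩ := exists_seq_forall_of_frequently h'
  exact ⟨Tn, fun n => (hp n).2, fun n => (hp n).1, hTn.mono_right nhdsWithin_le_nhds⟩

/-- **`seregin_regular_of_liminf_L3` from the local-Leray theory** (Lemarié-Rieusset 2016,
proof of Thm. 15.5, PDF pp. 570–573 of doi:10.1201/b19556; Seregin 2012, §§2–4): the named
facts `local_leray_weak_strong_uniqueness` (U, Thm. 14.7), `kato_isLocalLeraySolutionOn` (A,
Thm. 15.1 (A)), `lemarieRieusset_prop_15_1` (Prop. 15.1),
`lemarieRieusset_localLeray_compactness` (Thm. 12.1 and p. 571),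
`lemarieRieusset_singular_point_stability` (pp. 571–573 with Thm. 14.4) and
`lemarieRieusset_backward_uniqueness_slab` (Thm. 15.4) imply that a Kato solution with
`liminf_{t↑T} ‖u(t)‖₃ < ∞` has no singular point at time `T`. Real proof; see the module
docstring for the eight steps. [cite: LemarieRieusset2016, Thm. 15.5, proof pp. 570–573] [cite: Seregin2012CMP, §§2–4] -/
theorem seregin_regular_of_liminf_L3_of_localLeray (hU : local_leray_weak_strong_uniqueness)
    (hA₀ : kato_isLocalLeraySolutionOn) (hA : lemarieRieusset_prop_15_1)
    (hC : lemarieRieusset_localLeray_compactness)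
    (hD : lemarieRieusset_singular_point_stability)
    (hE : lemarieRieusset_backward_uniqueness_slab) : seregin_regular_of_liminf_L3 := by
  intro ν T hν hT u₀ u hu₀ hdiv hu hlim x₀
  by_contra hsing
  have hsing' : ∀ r : ℝ, 0 < r → eLpNorm (uncurry u) ∞
      (volume.restrict (parabolicCylinder r ((T : ℝ), x₀))) = ∞ := by
    intro r hr
    by_contra hne
    exact hsing ⟨r, hr, lt_top_iff_ne_top.2 hne⟩
  obtain ⟨M, hfreq⟩ := hlim
  -- ### Step 1: times `T_n ↑ T` with `‖u(T_n)‖₃ ≤ M`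
  obtain ⟨Tn, hTnI, hTnM, hTnT⟩ := exists_seq_of_frequently_nhdsLT hT hfreq
  set M' : ℝ := (M : ℝ) + 1 with hM'
  have hM'pos : 0 < M' := by rw [hM']; positivity
  have hTnM' : ∀ n, eLpNorm (u (Tn n)) 3 volume ≤ ENNReal.ofReal M' := fun n =>
    (hTnM n).trans (by
      rw [← ENNReal.ofReal_coe_nnreal, hM']
      exact ENNReal.ofReal_le_ofReal (by linarith))
  -- the scales `λ_n = √(T - T_n) → 0`
  set lam : ℕ → ℝ := fun n => Real.sqrt (T - Tn n) with hlam_def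
  have hsubpos : ∀ n, 0 < T - Tn n := fun n => sub_pos.2 (hTnI n).2
  have hlam : ∀ n, 0 < lam n := fun n => Real.sqrt_pos.2 (hsubpos n)
  have hlam2 : ∀ n, lam n ^ 2 = T - Tn n := fun n => Real.sq_sqrt (hsubpos n).le
  have hlam0 : Tendsto lam atTop (𝓝 0) := by
    have h1 : Tendsto (fun n => T - Tn n) atTop (𝓝 (T - T)) := tendsto_const_nhds.sub hTnT
    rw [sub_self] at h1
    have h2 := (Real.continuous_sqrt.tendsto 0).comp h1
    rwa [Real.sqrt_zero] at h2
  -- ### Step 2: the profile `U(T) ∈ L³`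
  have hTmem : T ∈ Icc (0 : ℝ) (T + 1) := ⟨hT.le, by linarith⟩
  set M₁ : ℝ := max M' (eLpNorm u₀ 3 volume).toReal + 1 with hM₁
  have hM₁pos : 0 < M₁ := by
    have := le_max_left M' (eLpNorm u₀ 3 volume).toReal
    rw [hM₁]; linarith
  have hu₀bd : eLpNorm u₀ 3 volume ≤ ENNReal.ofReal M₁ := by
    rw [← ENNReal.ofReal_toReal hu₀.eLpNorm_ne_top]
    refine ENNReal.ofReal_le_ofReal ?_
    have := le_max_right M' (eLpNorm u₀ 3 volume).toReal
    rw [hM₁]; linarith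
  obtain ⟨C₁, η₁, -, hA₁⟩ := hA hν M₁ (T + 1) hM₁pos (by linarith)
  obtain ⟨U, P, hUsol, -, -, -⟩ := hA₁ u₀ hu₀ hu₀bd hdiv
  have hUu : ∀ s ∈ Ioo 0 T, U s =ᵐ[volume] u s := fun s hs =>
    IsLocalEnergySolutionOn.ae_eq_kato_slice hU hA₀ hν hu hUsol s
      ⟨hs.1, by rw [min_eq_right (by linarith)]; exact hs.2⟩
  have hUT : MemLp (U T) 3 volume := by
    refine (FunctionSpaces.memLp_three_of_forall_abs_integral_inner_le
      (hUsol.sliceMeasurable T hTmem) ?_ (by positivity : (0 : ℝ) ≤ M) ?_).1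
    · intro x
      refine ⟨ball x 1, ball_mem_nhds x one_pos, ?_⟩
      have h2 := hUsol.memLp_two_ball hTmem x
      exact (memLp_two_iff_integrable_sq_norm h2.1).1 h2
    · intro φ hφ
      have hcont := hUsol.weakContinuous φ hφ
      have hlimg : Tendsto (fun n => ∫ x, ⟪U (Tn n) x, φ x⟫) atTop
          (𝓝 (∫ x, ⟪U T x, φ x⟫)) := by
        have h1 : Tendsto Tn atTop (𝓝[Icc 0 (T + 1)] T) :=
          tendsto_nhdsWithin_iff.2 ⟨hTnT, Eventually.of_forall fun n =>
            ⟨(hTnI n).1.le, by linarith [(hTnI n).2]⟩⟩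
        exact (hcont T hTmem).tendsto.comp h1
      have hφq : MemLp φ (3 / 2 : ℝ≥0∞) volume :=
        hφ.contDiff.continuous.memLp_of_hasCompactSupport hφ.hasCompactSupport
      have hbd : ∀ n, |∫ x, ⟪U (Tn n) x, φ x⟫| ≤
          (M : ℝ) * (eLpNorm φ (3 / 2 : ℝ≥0∞) volume).toReal := by
        intro n
        rw [integral_congr_ae (show (fun x => ⟪U (Tn n) x, φ x⟫) =ᵐ[volume]
          (fun x => ⟪u (Tn n) x, φ x⟫) from (hUu (Tn n) (hTnI n)).mono fun x hx => by simp only [hx])]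
        have hH := abs_integral_inner_le_eLpNorm_three_mul
          (hu.memLp ⟨(hTnI n).1.le, (hTnI n).2⟩) hφq
        refine hH.trans (mul_le_mul_of_nonneg_right ?_ ENNReal.toReal_nonneg)
        have h3 := ENNReal.toReal_mono ENNReal.coe_ne_top (hTnM n)
        rwa [ENNReal.coe_toReal] at h3
      exact le_of_tendsto ((continuous_abs.tendsto _).comp hlimg) (Eventually.of_forall hbd)
  -- ### Step 3: the blow-up sequence `u_n(t, x) = λ_n u(T_n + λ_n² t, x₀ + λ_n x)`
  obtain ⟨uN, hfu⟩ : ∃ uN : ℕ → ℝ → EuclideanSpace ℝ (Fin 3) → EuclideanSpace ℝ (Fin 3),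
      ∀ n, uN n = fun t x => lam n • u (Tn n + lam n ^ 2 * t) (x₀ + lam n • x) :=
    ⟨_, fun _ => rfl⟩
  obtain ⟨a, hfa⟩ : ∃ a : ℕ → EuclideanSpace ℝ (Fin 3) → EuclideanSpace ℝ (Fin 3),
      ∀ n, a n = fun x => lam n • u (Tn n) (x₀ + lam n • x) := ⟨_, fun _ => rfl⟩
  have hfu' : ∀ n t x, uN n t x = lam n • u (Tn n + lam n ^ 2 * t) (x₀ + lam n • x) :=
    fun n t x => by rw [hfu n]
  have hKato : ∀ n, IsKatoSolutionOn 1 ν (a n) (uN n) := by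
    intro n
    have hs : Tn n ∈ Ico 0 T := ⟨(hTnI n).1.le, (hTnI n).2⟩
    have hrest := hu.restart hν hs
    have hbl := isKatoSolutionOn_blowup hrest (hlam n) x₀
    have e : (T - Tn n) / lam n ^ 2 = 1 := by rw [hlam2 n, div_self (hsubpos n).ne']
    rw [e] at hbl
    rw [hfa n, hfu n]
    exact hbl
  have ha3 : ∀ n, MemLp (a n) 3 volume ∧ eLpNorm (a n) 3 volume ≤ ENNReal.ofReal M' ∧
      IsWeaklyDivFree (a n) := by
    intro n
    refine ⟨(hKato n).memLp_initial one_pos, ?_, (hKato n).isWeaklyDivFree_initial one_pos⟩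
    rw [hfa n, eLpNorm_three_blowupData _ (hlam n)]
    exact hTnM' n
  -- `u_n` is unbounded on every backward cylinder at `(1, 0)`
  have huNsing : ∀ n, ∀ r : ℝ, 0 < r → eLpNorm (uncurry (uN n)) ∞ (volume.restrict
      (parabolicCylinder r ((1 : ℝ), (0 : EuclideanSpace ℝ (Fin 3))))) = ∞ := by
    intro n r hr
    rw [hfu n, eLpNorm_top_uncurry_blowup u (hlam n) (Tn n) x₀ r 1 0, mul_one, smul_zero, add_zero,
      hlam2 n, show Tn n + (T - Tn n) = T by ring, hsing' _ (mul_pos (hlam n) hr)]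
    exact ENNReal.mul_top (enorm_ne_zero.2 (hlam n).ne')
  -- ### Step 4: local Leray continuations `v_n` on `(0, 2)` with uniform control
  obtain ⟨C, η, hη, hA₂⟩ := hA hν M' 2 hM'pos two_pos
  have hex : ∀ n, ∃ (v : ℝ → EuclideanSpace ℝ (Fin 3) → EuclideanSpace ℝ (Fin 3))
      (π : ℝ → EuclideanSpace ℝ (Fin 3) → ℝ),
      IsLocalEnergySolutionOn 2 ν (a n) v π ∧
      (∀ t ∈ Icc (0 : ℝ) 2, ∀ y : EuclideanSpace ℝ (Fin 3),
        ∫⁻ x in ball y 1, ‖v t x‖ₑ ^ 2 ≤ C) ∧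
      (∃ G : ℝ → EuclideanSpace ℝ (Fin 3) →
          EuclideanSpace ℝ (Fin 3) →L[ℝ] EuclideanSpace ℝ (Fin 3),
        HasWeakSpatialGradientOn
            (slab (EuclideanSpace ℝ (Fin 3)) (Ioo 0 2) isOpen_Ioo) v G ∧
          ∀ y : EuclideanSpace ℝ (Fin 3), ∫⁻ z in Ioo (0 : ℝ) 2 ×ˢ ball y 1,
            ENNReal.ofReal (frobeniusNormSq (G z.1 z.2)) ≤ C) ∧
      ∀ t ∈ Ioo (0 : ℝ) 2, ∀ y : EuclideanSpace ℝ (Fin 3),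
        eLpNorm (v t - heatTest ν (a n) t) 2 (volume.restrict (ball y 1)) ≤ η t :=
    fun n => hA₂ (a n) (ha3 n).1 (ha3 n).2.1 (ha3 n).2.2
  choose v π hv hvC hvG hvLay using hex
  -- `v_n = u_n` on `(0, 1)`
  have hvu : ∀ n, ∀ t ∈ Ioo (0 : ℝ) 1, v n t =ᵐ[volume] uN n t := fun n t ht =>
    IsLocalEnergySolutionOn.ae_eq_kato_slice hU hA₀ hν (hKato n) (hv n) t
      ⟨ht.1, by rw [min_eq_right (by norm_num : (1 : ℝ) ≤ 2)]; exact ht.2⟩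
  -- hence `v_n` is unbounded on every backward cylinder at `(1, 0)`
  have hvsing : ∀ n, ∀ r : ℝ, 0 < r → eLpNorm (uncurry (v n)) ∞ (volume.restrict
      (parabolicCylinder r ((1 : ℝ), (0 : EuclideanSpace ℝ (Fin 3))))) = ∞ := by
    intro n
    refine fun r hr => eLpNorm_top_parabolicCylinder_eq_top_of_small one_pos
      (fun ρ hρ hρ1 => ?_) hr
    have hae : uncurry (v n) =ᵐ[volume.restrict (Ioo (0 : ℝ) 1 ×ˢ
        (univ : Set (EuclideanSpace ℝ (Fin 3))))] uncurry (uN n) :=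
      FunctionSpaces.ae_eq_uncurry_of_forall_mem_slice_ae measurableSet_Ioo
        ((hv n).aestronglyMeasurable.mono_measure (Measure.restrict_mono
          (Set.prod_mono (Ioo_subset_Ioo_right (by norm_num)) Subset.rfl) le_rfl))
        (hKato n).aestronglyMeasurable (hvu n)
    have hsub : parabolicCylinder ρ ((1 : ℝ), (0 : EuclideanSpace ℝ (Fin 3))) ⊆
        Ioo (0 : ℝ) 1 ×ˢ (univ : Set (EuclideanSpace ℝ (Fin 3))) := by
      intro z hz
      rw [mem_parabolicCylinder] at hz
      exact ⟨⟨by nlinarith [hz.1.1], hz.1.2⟩, mem_univ _⟩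
    rw [eLpNorm_congr_ae (hae.filter_mono (ae_mono (Measure.restrict_mono hsub le_rfl)))]
    exact huNsing n ρ hρ
  -- the final slice of `v_n` is the rescaled profile `g_n = λ_n U(T)(x₀ + λ_n ·)`
  have hg3 : ∀ n, MemLp (fun x => lam n • U T (x₀ + lam n • x)) 3 volume := fun n =>
    memLp_three_blowupData hUT (hlam n) x₀
  have hvfin : ∀ n, v n 1 =ᵐ[volume] fun x => lam n • U T (x₀ + lam n • x) := by
    intro n
    have hcn := hlam n
    refine FunctionSpaces.ae_eq_of_forall_integral_inner_test_eq
      ((hv n).locallyIntegrable_slice ⟨zero_le_one, one_le_two⟩)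
      ((hg3 n).locallyIntegrable (by norm_num)) fun φ hφ => ?_
    have hψ : FunctionSpaces.IsTestFunctionOn (⊤ : Opens (EuclideanSpace ℝ (Fin 3)))
        (fun y => φ ((lam n)⁻¹ • (y - x₀))) :=
      isTestFunctionOn_comp_inv_smul_sub hφ hcn.ne' x₀
    -- (i) `∫⟪v_n(t), φ⟫ → ∫⟪v_n(1), φ⟫` as `t ↑ 1`
    have hF : Tendsto (fun t => ∫ x, ⟪v n t x, φ x⟫) (𝓝[Ioo (0 : ℝ) 1] 1)
        (𝓝 (∫ x, ⟪v n 1 x, φ x⟫)) :=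
      (((hv n).weakContinuous φ hφ) 1 ⟨zero_le_one, one_le_two⟩).tendsto.mono_left
        (nhdsWithin_mono _ fun t ht => ⟨ht.1.le, ht.2.le.trans one_le_two⟩)
    -- (ii) for `t ∈ (0, 1)` the pairing is a pairing of `U(T_n + λ_n² t)`
    have hEq : ∀ t ∈ Ioo (0 : ℝ) 1, ∫ x, ⟪v n t x, φ x⟫ =
        lam n * (lam n ^ 3)⁻¹ * ∫ y, ⟪U (Tn n + lam n ^ 2 * t) y, φ ((lam n)⁻¹ • (y - x₀))⟫ := by
      intro t ht
      have hs : Tn n + lam n ^ 2 * t ∈ Ioo 0 T := by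
        rw [hlam2 n]
        have h0 := (hTnI n).1
        have hp := hsubpos n
        constructor <;> nlinarith [ht.1, ht.2]
      have hqmp : Measure.QuasiMeasurePreserving
          (fun x : EuclideanSpace ℝ (Fin 3) => x₀ + lam n • x) volume volume :=
        ⟨(measurable_const_add x₀).comp (measurable_const_smul (lam n)), by
          rw [map_space_affine_volume hcn]; exact Measure.smul_absolutelyContinuous⟩
      have h2 : (fun x => U (Tn n + lam n ^ 2 * t) (x₀ + lam n • x)) =ᵐ[volume]
          fun x => u (Tn n + lam n ^ 2 * t) (x₀ + lam n • x) :=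
        hqmp.ae_eq_comp (hUu _ hs)
      have h1 : (fun x => ⟪v n t x, φ x⟫) =ᵐ[volume]
          fun x => ⟪lam n • U (Tn n + lam n ^ 2 * t) (x₀ + lam n • x), φ x⟫ := by
        filter_upwards [hvu n t ht, h2] with x hx1 hx2
        rw [hx1, hfu' n t x, ← hx2]
      rw [integral_congr_ae h1,
        integral_inner_blowup_eq_fin3 (U (Tn n + lam n ^ 2 * t)) φ hcn x₀]
    -- (iii) `∫⟪U(T_n + λ_n² t), φ_n⟫ → ∫⟪U(T), φ_n⟫` as `t ↑ 1`
    have hG : Tendsto (fun t => lam n * (lam n ^ 3)⁻¹ *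
        ∫ y, ⟪U (Tn n + lam n ^ 2 * t) y, φ ((lam n)⁻¹ • (y - x₀))⟫) (𝓝[Ioo (0 : ℝ) 1] 1)
        (𝓝 (lam n * (lam n ^ 3)⁻¹ * ∫ y, ⟪U T y, φ ((lam n)⁻¹ • (y - x₀))⟫)) := by
      refine Tendsto.const_mul _ ?_
      have hmap : Tendsto (fun t => Tn n + lam n ^ 2 * t) (𝓝[Ioo (0 : ℝ) 1] 1)
          (𝓝[Icc 0 (T + 1)] T) := by
        have hc : Continuous fun t : ℝ => Tn n + lam n ^ 2 * t := by fun_prop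
        have hval : Tn n + lam n ^ 2 * 1 = T := by rw [hlam2 n]; ring
        refine tendsto_nhdsWithin_iff.2 ⟨?_, ?_⟩
        · have := hc.tendsto 1
          rw [hval] at this
          exact this.mono_left nhdsWithin_le_nhds
        · filter_upwards [self_mem_nhdsWithin] with t ht
          rw [hlam2 n]
          have h0 := (hTnI n).1
          have hp := hsubpos n
          constructor <;> nlinarith [ht.1, ht.2]
      exact ((hUsol.weakContinuous _ hψ) T hTmem).tendsto.comp hmap
    -- the two limits along `t ↑ 1` agree
    haveI : (𝓝[Ioo (0 : ℝ) 1] (1 : ℝ)).NeBot := by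
      refine mem_closure_iff_nhdsWithin_neBot.1 ?_
      rw [closure_Ioo zero_ne_one]
      exact ⟨zero_le_one, le_rfl⟩
    have hlim1 : Tendsto (fun t => ∫ x, ⟪v n t x, φ x⟫) (𝓝[Ioo (0 : ℝ) 1] 1)
        (𝓝 (lam n * (lam n ^ 3)⁻¹ * ∫ y, ⟪U T y, φ ((lam n)⁻¹ • (y - x₀))⟫)) :=
      hG.congr' (eventually_mem_nhdsWithin.mono fun t ht => (hEq t ht).symm)
    rw [tendsto_nhds_unique hF hlim1]
    show _ = ∫ x, ⟪lam n • U T (x₀ + lam n • x), φ x⟫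
    rw [integral_inner_blowup_eq_fin3 (U T) φ hcn x₀]
  -- ### Step 5: the limiting procedure
  obtain ⟨σ, aL, vL, πL, hσ, haL3, -, haLdiv, hvL, -, -, hvLw, hvLs⟩ :=
    hC (T₀ := 2) (T₁ := 1) hν one_pos (by norm_num) M' C η hη a v π ha3 hv hvC hvG hvLay
  -- ### Step 6: the limit is singular at `(1, 0)`
  have hvLsing : ∀ r : ℝ, 0 < r → r ^ 2 < 1 → eLpNorm (uncurry vL) ∞ (volume.restrict
      (parabolicCylinder r ((1 : ℝ), (0 : EuclideanSpace ℝ (Fin 3))))) = ∞ := by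
    intro r hr hr1
    by_contra hne
    obtain ⟨r₁, hr₁, hev⟩ := hD hν one_pos C (fun k => a (σ k)) (fun k => v (σ k))
      (fun k => π (σ k)) aL vL πL
      (fun k => ((hv (σ k)).mono one_le_two).isLocalLeraySolutionOn) hvL.isLocalLeraySolutionOn
      (fun k => (ae_restrict_mem measurableSet_Ioo).mono fun t ht y =>
        hvC (σ k) t ⟨ht.1.le, ht.2.le.trans one_le_two⟩ y)
      (fun k => by
        obtain ⟨G, hG, hGC⟩ := hvG (σ k)
        exact ⟨G, hG.mono (slab_mono (Ioo_subset_Ioo_right one_le_two)), fun y =>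
          (lintegral_mono_set (Set.prod_mono (Ioo_subset_Ioo_right one_le_two) Subset.rfl)).trans
            (hGC y)⟩)
      hvLs 0 ⟨r, hr, hr1, lt_top_iff_ne_top.2 hne⟩
    obtain ⟨k, hk⟩ := hev.exists
    exact absurd (hvsing (σ k) r₁ hr₁) hk.ne
  -- ### Step 7: the final slice of the limit vanishes
  have hfinal : vL 1 =ᵐ[volume] 0 := by
    refine FunctionSpaces.ae_eq_zero_of_forall_integral_inner_test_eq_zero
      (hvL.locallyIntegrable_slice ⟨zero_le_one, le_rfl⟩) fun φ hφ => ?_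
    have h1 := hvLw 1 ⟨zero_le_one, le_rfl⟩ φ hφ
    have h2 : (fun k => ∫ x, ⟪v (σ k) 1 x, φ x⟫) =
        fun k => ∫ x, ⟪lam (σ k) • U T (x₀ + lam (σ k) • x), φ x⟫ := by
      funext k
      exact integral_congr_ae ((hvfin (σ k)).mono fun x hx => by simp only [hx])
    rw [h2] at h1
    have h3 := tendsto_integral_inner_blowup_of_memLp_three_fin3 hUT hφ x₀
      (fun k => hlam (σ k)) (hlam0.comp hσ.tendsto_atTop)
    exact tendsto_nhds_unique h1 h3
  -- ### Step 8: backward uniqueness, and the contradiction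
  have hfinal' : ∀ φ : EuclideanSpace ℝ (Fin 3) → EuclideanSpace ℝ (Fin 3),
      FunctionSpaces.IsTestFunctionOn (⊤ : Opens (EuclideanSpace ℝ (Fin 3))) φ →
        Tendsto (fun t => ∫ x, ⟪vL t x, φ x⟫) (𝓝[<] 1) (𝓝 0) := by
    intro φ hφ
    have h1 : Tendsto (fun t => ∫ x, ⟪vL t x, φ x⟫) (𝓝[Icc (0 : ℝ) 1] 1)
        (𝓝 (∫ x, ⟪vL 1 x, φ x⟫)) := ((hvL.weakContinuous φ hφ) 1 ⟨zero_le_one, le_rfl⟩).tendsto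
    have h0 : ∫ x, ⟪vL 1 x, φ x⟫ = 0 := by
      rw [integral_congr_ae (show (fun x => ⟪vL 1 x, φ x⟫) =ᵐ[volume] fun _ => (0 : ℝ) from
        hfinal.mono fun x hx => by simp [hx])]
      exact integral_zero _ _
    rw [h0] at h1
    have hfilter : 𝓝[<] (1 : ℝ) = 𝓝[Ioo (0 : ℝ) 1] 1 := by
      rw [← nhdsWithin_inter_of_mem' (mem_nhdsWithin_of_mem_nhds (Ioi_mem_nhds one_pos)),
        Iio_inter_Ioi]
    rw [hfilter]
    exact h1.mono_left (nhdsWithin_mono _ Ioo_subset_Icc_self)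
  have hzero : ∀ᵐ z ∂(volume.restrict (Ioo (0 : ℝ) 1 ×ˢ (univ : Set (EuclideanSpace ℝ (Fin 3))))),
      vL z.1 z.2 = 0 := hE hν one_pos haL3 haLdiv hvL.isLocalLeraySolutionOn hfinal'
  have hae0 : uncurry vL =ᵐ[volume.restrict (Ioo (0 : ℝ) 1 ×ˢ
      (univ : Set (EuclideanSpace ℝ (Fin 3))))]
      (0 : ℝ × EuclideanSpace ℝ (Fin 3) → EuclideanSpace ℝ (Fin 3)) :=
    hzero.mono fun z hz => hz
  have hsub : parabolicCylinder (1 / 2) ((1 : ℝ), (0 : EuclideanSpace ℝ (Fin 3))) ⊆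
      Ioo (0 : ℝ) 1 ×ˢ (univ : Set (EuclideanSpace ℝ (Fin 3))) := by
    intro z hz
    rw [mem_parabolicCylinder] at hz
    exact ⟨⟨by nlinarith [hz.1.1], hz.1.2⟩, mem_univ _⟩
  have h0 : eLpNorm (uncurry vL) ∞ (volume.restrict
      (parabolicCylinder (1 / 2) ((1 : ℝ), (0 : EuclideanSpace ℝ (Fin 3))))) = 0 := by
    rw [eLpNorm_congr_ae (hae0.filter_mono (ae_mono (Measure.restrict_mono hsub le_rfl)))]
    exact eLpNorm_zero
  have htop := hvLsing (1 / 2) (by norm_num) (by norm_num)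
  rw [h0] at htop
  exact ENNReal.zero_ne_top htop

/-- **Dependency-tracker form**: `seregin_L3_blowup_mild` (Lemarié-Rieusset 2016, Thm. 15.5)
from Thm. 15.1 (C), U (Thm. 14.7), A (Thm. 15.1 (A)) and the four local-Leray facts (composition
with the accepted `seregin_L3_blowup_mild_of_singular_point`). [cite: LemarieRieusset2016, Thm. 15.5] -/
theorem seregin_L3_blowup_mild_of_localLeray (h1 : lemarieRieusset_singular_point_of_blowup)
    (hU : local_leray_weak_strong_uniqueness) (hA₀ : kato_isLocalLeraySolutionOn)
    (hA : lemarieRieusset_prop_15_1) (hC : lemarieRieusset_localLeray_compactness)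
    (hD : lemarieRieusset_singular_point_stability)
    (hE : lemarieRieusset_backward_uniqueness_slab) : seregin_L3_blowup_mild :=
  seregin_L3_blowup_mild_of_singular_point h1
    (seregin_regular_of_liminf_L3_of_localLeray hU hA₀ hA hC hD hE)

end Literature.Analysis.FluidPDE

end
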